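import Summits.CriticalPhenomena.PercolationContinuityZ3.Theorems.PercNearOneGluingNoHeavyQuantSubfloorHubLaws
import HarnessLib

/-!
# QUANT lane R8, T-DEC: THE SUB-FLOOR HUB OF A LIST OF FAR-GIANT PIECES OF A GENERAL SHAPE `{lo, lo+K; γ}` — definition `sHub lo K`, law facts,
# support on the progression `lo·j + K·s` and LIKELIHOOD-RATIO DOMINANCE by induction on the list (census-1 gen 31; shape-general form of
# `…QuantSubfloorHubLaws`)

builds on p205010 (kernel theorem, internal audit signed; external expert review pending)

Support + definition file (`--supports stmt-CriticalPhenomena-4575`), QUANT lane seat prim-quant-census-1 (gen 31); memo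
`run/shared/lean/prim/quant/prim-quant-census-1/g31/HUB-GENERAL-G31.md` §3.  One definition (`sHub`), theorems with standard axioms, no sorries.
Uses `lconv_laws` (g30), `lconv_mix_right` (census-1 g28 `…QuantSiblingMixture`).

THE OBJECT.  The far-giant piece of the glued sibling `R^lo[q](R^K[g])` is `S(γ) = {lo: 1−γ, lo+K: γ}` (`lo` sure relays over a glued `K`-block at
gate `γ`); `sHub lo K [] = δ₀`, `sHub lo K (γ :: P) = sHub lo K P ∗ S(γ)` (`lconv ((lo+K)|P|) (lo+K)`) is the law of `lo·j + K·Σ Bern(γᵢ)`: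
atoms `lo·j + K·s`, masses the Poisson-binomial weights `u_s` (the SAME weights as for `cHub = sHub 1 2`).

* `lconv_point_right` (`(F ∗ δ_k)(h) = [k ≤ h]·F(h−k)`), `lconv_sp_apply` (`(F ∗ S(γ))(h) = (1−γ)F(h−lo) + γF(h−lo−K)`),
  `sHub_laws` (probability law on `{0..(lo+K)j}`, mean `Σ(lo + Kγᵢ)`);
* **`sHub_struct`** (`lo < K`; `0 ≤ o`, `o(1−γᵢ) ≤ γᵢ`): SUPPORT `sHub P h ≠ 0 ⟹ h = lo·j + K·s`, `s ≤ j`; LIKELIHOOD-RATIO DOMINANCE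
  `o·((lo+K)j − h)·u(h) ≤ (h + K − lo·j)·u(h + K)` for every `h` (in `s`-indexing `o(j−s)u_s ≤ (s+1)u_{s+1}`); the induction step is the identity
  `RHS − LHS ≥ K·u(h−lo)·(γ − o(1−γ)) ≥ 0`.

HONEST STATUS.  Tools; `SiblingStep`, `GluedDominated'`, `SDECConvClosed`, `FarTreeRow` OPEN; RATE class (log\*) / honest sentence of
`run/shared/lean/prim/quant/README.md` unchanged.  [this work].  Nothing here is cited as a published result.  The gluing rows served
[cite: KozmaNitzan2024, Conjecture 3 (p. 15)]; product measure [cite: Grimmett1999, §1.3 p. 10].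
-/

noncomputable section

open scoped BigOperators

namespace Summit.CriticalPhenomena.PercolationContinuityZ3.Theorems
namespace Quant
namespace LawDec

open Finset

/-- the point mass `δ_K` -/
local notation3 "δ[" K "]" => (fun k : ℕ => if k = (K : ℕ) then (1 : ℝ) else 0)

/-- the FAR-GIANT PIECE of shape `(lo, K)`: `S(γ) = {lo: 1−γ, lo+K: γ}` -/
local notation3 "SP[" lo ", " K ", " a "]" => (fun h : ℕ => (1 - (a : ℝ)) * (if h = (lo : ℕ) then (1 : ℝ) else 0) +
  (a : ℝ) * (if h = (lo : ℕ) + (K : ℕ) then (1 : ℝ) else 0))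

/-! ### The hub of a list of pieces of shape `(lo, K)` -/

/-- **the sub-floor hub of a list of far-giant pieces of shape `(lo, K)`**: `sHub lo K [] = δ₀`, `sHub lo K (γ :: P) = sHub lo K P ∗ S(γ)`.
[this work] -/
def sHub (lo K : ℕ) : List ℝ → ℕ → ℝ
  | [] => δ[0]
  | γ :: P => lconv ((lo + K) * P.length) (lo + K) (sHub lo K P) SP[lo, K, γ]

/-- `(F ∗ δ_k)(h) = [k ≤ h]·F(h − k)` for `k ≤ M` and `F` vanishing above `N`. [this work] -/
theorem lconv_point_right (N M k : ℕ) (F : ℕ → ℝ) (hk : k ≤ M) (hF : ∀ i, N < i → F i = 0) (h : ℕ) :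
    lconv N M F δ[k] h = if k ≤ h then F (h - k) else 0 := by
  simp only [lconv]
  have e : ∀ i ∈ Finset.range (N + 1), ∑ m ∈ Finset.range (M + 1), (if i + m = h then F i * δ[k] m else 0)
      = (if i + k = h then F i else 0) := by
    intro i _
    rw [Finset.sum_eq_single_of_mem k (Finset.mem_range.2 (Nat.lt_succ_of_le hk))]
    · simp
    · intro m _ hm
      have : (if m = k then (1 : ℝ) else 0) = 0 := if_neg hm
      simp only [this, mul_zero, ite_self]
  rw [Finset.sum_congr rfl e]
  by_cases hkh : k ≤ h
  · rw [if_pos hkh]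
    have e2 : ∀ i, (if i + k = h then F i else 0) = (if i = h - k then F i else 0) := fun i => by
      by_cases hi : i + k = h
      · rw [if_pos hi, if_pos (show i = h - k by omega)]
      · rw [if_neg hi, if_neg (show ¬ (i = h - k) by omega)]
    simp_rw [e2]
    rw [Finset.sum_ite_eq']
    split_ifs with hm
    · rfl
    · have : ¬ (h - k < N + 1) := fun hh => hm (Finset.mem_range.2 hh)
      exact (hF _ (by omega)).symm
  · rw [if_neg hkh]
    exact Finset.sum_eq_zero fun i _ => by rw [if_neg (show ¬ (i + k = h) by omega)]

/-- **`(F ∗ S(γ))(h) = (1−γ)·[lo ≤ h]F(h−lo) + γ·[lo+K ≤ h]F(h−lo−K)`** for `F` vanishing above `N`. [this work] -/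
theorem lconv_sp_apply (lo K N : ℕ) (F : ℕ → ℝ) (γ : ℝ) (hF : ∀ i, N < i → F i = 0) (h : ℕ) :
    lconv N (lo + K) F SP[lo, K, γ] h
      = (1 - γ) * (if lo ≤ h then F (h - lo) else 0) + γ * (if lo + K ≤ h then F (h - (lo + K)) else 0) := by
  have hmix : ∀ m, SP[lo, K, γ] m = (1 - γ) * δ[lo] m + (1 - (1 - γ)) * δ[lo + K] m := fun m => by ring
  rw [lconv_mix_right N (lo + K) F _ δ[lo] δ[lo + K] (1 - γ) hmix h, lconv_point_right N (lo + K) lo F (Nat.le_add_right _ _) hF h,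
    lconv_point_right N (lo + K) (lo + K) F le_rfl hF h]
  ring

/-- **law facts of the hub of shape `(lo, K)`**: nonnegative, vanishing above `(lo+K)|P|`, mass `1`, mean `Σ (lo + Kγᵢ)`. [this work] -/
theorem sHub_laws (lo K : ℕ) : ∀ P : List ℝ, (∀ γ ∈ P, 0 ≤ γ ∧ γ ≤ 1) →
    (∀ h, 0 ≤ sHub lo K P h) ∧ (∀ h, (lo + K) * P.length < h → sHub lo K P h = 0) ∧
      ∑ h ∈ Finset.range ((lo + K) * P.length + 1), sHub lo K P h = 1 ∧
      ∑ h ∈ Finset.range ((lo + K) * P.length + 1), (h : ℝ) * sHub lo K P h = (P.map (fun γ => (lo : ℝ) + K * γ)).sum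
  | [], _ => by
    refine ⟨fun h => ?_, fun h hh => ?_, ?_, ?_⟩
    · show (0 : ℝ) ≤ (if h = 0 then (1 : ℝ) else 0); split_ifs <;> norm_num
    · show (if h = 0 then (1 : ℝ) else 0) = 0; rw [if_neg (by simp at hh; omega)]
    · simp [sHub]
    · simp [sHub]
  | γ :: P, hP => by
    have hγ := hP γ (by simp)
    have hP' : ∀ γ' ∈ P, 0 ≤ γ' ∧ γ' ≤ 1 := fun γ' h' => hP γ' (List.mem_cons_of_mem γ h')
    obtain ⟨a0, _, a1, am⟩ := sHub_laws lo K P hP'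
    -- laws of the piece
    have c0 : ∀ h, 0 ≤ SP[lo, K, γ] h := fun h => by
      dsimp only; split_ifs <;> nlinarith [hγ.1, hγ.2]
    have c1 : ∑ h ∈ Finset.range (lo + K + 1), SP[lo, K, γ] h = 1 := by
      simp only [Finset.sum_add_distrib, ← Finset.mul_sum, Finset.sum_ite_eq', Finset.mem_range]
      rw [if_pos (by omega), if_pos (by omega)]; ring
    have cm : ∑ h ∈ Finset.range (lo + K + 1), (h : ℝ) * SP[lo, K, γ] h = (lo : ℝ) + K * γ := by
      have e : ∀ h : ℕ, (h : ℝ) * SP[lo, K, γ] h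
          = (1 - γ) * (if h = lo then ((lo : ℕ) : ℝ) else 0) + γ * (if h = lo + K then (((lo + K : ℕ)) : ℝ) else 0) := by
        intro h; dsimp only
        by_cases h1 : h = lo
        · by_cases h2 : h = lo + K
          · have hK : K = 0 := by omega
            rw [if_pos h1, if_pos h2, if_pos h1, if_pos h2, h1, hK]; push_cast; ring
          · rw [if_pos h1, if_neg h2, if_pos h1, if_neg h2, h1]; ring
        · by_cases h2 : h = lo + K
          · rw [if_neg h1, if_pos h2, if_neg h1, if_pos h2, h2]; ring
          · rw [if_neg h1, if_neg h2, if_neg h1, if_neg h2]; ring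
      simp only [e, Finset.sum_add_distrib, ← Finset.mul_sum, Finset.sum_ite_eq', Finset.mem_range]
      rw [if_pos (by omega), if_pos (by omega)]; push_cast; ring
    obtain ⟨b0, bM, b1, bm⟩ := lconv_laws a0 a1 am c0 c1 cm
    have eT : (lo + K) * (γ :: P).length = (lo + K) * P.length + (lo + K) := by simp [List.length_cons]; ring
    simp only [sHub, List.map_cons, List.sum_cons]
    rw [eT]
    refine ⟨b0, bM, b1, ?_⟩
    rw [bm]; ring

/-- **structure of the hub of shape `(lo, K)`** (`lo < K`; `0 ≤ o` with `o(1−γ) ≤ γ` for every `γ ∈ P`): SUPPORT — a charged atom is `lo·|P| + K·s`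
with `s ≤ |P|` — and LIKELIHOOD-RATIO DOMINANCE — `o·((lo+K)|P| − h)·u(h) ≤ (h + K − lo·|P|)·u(h + K)` for every `h`. [this work] -/
theorem sHub_struct (lo K : ℕ) (hloK : lo < K) (o : ℝ) (ho : 0 ≤ o) : ∀ P : List ℝ, (∀ γ ∈ P, 0 ≤ γ ∧ γ ≤ 1 ∧ o * (1 - γ) ≤ γ) →
    (∀ h, sHub lo K P h ≠ 0 → ∃ s, h = lo * P.length + K * s ∧ s ≤ P.length) ∧
    (∀ h : ℕ, o * (((lo : ℝ) + K) * P.length - h) * sHub lo K P h ≤ ((h : ℝ) + K - (lo : ℝ) * P.length) * sHub lo K P (h + K))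
  | [], _ => by
    have hdef : sHub lo K [] = δ[0] := rfl
    refine ⟨fun h hh => ⟨0, ?_, le_rfl⟩, fun h => ?_⟩
    · have h0 : h = 0 := by
        by_contra hne
        exact hh (by rw [hdef]; exact if_neg hne)
      subst h0; simp
    · rw [hdef]
      have hK0 : 0 < K := lt_of_le_of_lt (Nat.zero_le lo) hloK
      have e2 : (if h + K = (0 : ℕ) then (1 : ℝ) else 0) = 0 := if_neg (by omega)
      simp only [e2, mul_zero, List.length_nil, Nat.cast_zero]
      by_cases h0 : h = 0
      · subst h0; simp
      · rw [if_neg h0, mul_zero]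
  | γ :: P, hP => by
    have hγ := hP γ (by simp)
    have hP' : ∀ γ' ∈ P, 0 ≤ γ' ∧ γ' ≤ 1 ∧ o * (1 - γ') ≤ γ' := fun γ' h' => hP γ' (List.mem_cons_of_mem γ h')
    obtain ⟨hsupp, hlr⟩ := sHub_struct lo K hloK o ho P hP'
    obtain ⟨a0, aM, _, _⟩ := sHub_laws lo K P (fun γ' h' => ⟨(hP' γ' h').1, (hP' γ' h').2.1⟩)
    set j : ℕ := P.length with hj
    set μ : ℕ → ℝ := sHub lo K P with hμ
    have hdef : sHub lo K (γ :: P) = lconv ((lo + K) * j) (lo + K) μ SP[lo, K, γ] := rfl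
    have happ : ∀ h, sHub lo K (γ :: P) h
        = (1 - γ) * (if lo ≤ h then μ (h - lo) else 0) + γ * (if lo + K ≤ h then μ (h - (lo + K)) else 0) :=
      fun h => by rw [hdef]; exact lconv_sp_apply lo K ((lo + K) * j) μ γ aM h
    have hlen : (γ :: P).length = j + 1 := by simp [hj]
    refine ⟨fun h hh => ?_, fun h => ?_⟩
    · -- support
      rw [happ] at hh
      by_cases hA : (if lo ≤ h then μ (h - lo) else 0) = 0
      · rw [hA, mul_zero, zero_add] at hh
        have hB : (if lo + K ≤ h then μ (h - (lo + K)) else 0) ≠ 0 := fun e => hh (by rw [e, mul_zero])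
        have h3 : lo + K ≤ h := by by_contra hc; exact hB (if_neg hc)
        rw [if_pos h3] at hB
        obtain ⟨s, hs, hsj⟩ := hsupp (h - (lo + K)) hB
        refine ⟨s + 1, ?_, by rw [hlen]; omega⟩
        rw [hlen]
        have : h = lo * j + K * s + (lo + K) := by omega
        rw [this]; ring
      · have h1 : lo ≤ h := by by_contra hc; exact hA (if_neg hc)
        rw [if_pos h1] at hA
        obtain ⟨s, hs, hsj⟩ := hsupp (h - lo) hA
        refine ⟨s, ?_, by rw [hlen]; omega⟩
        rw [hlen]
        have : h = lo * j + K * s + lo := by omega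
        rw [this]; ring
    · -- likelihood-ratio dominance
      set A : ℝ := (if lo ≤ h then μ (h - lo) else 0) with hA
      set B : ℝ := (if lo + K ≤ h then μ (h - (lo + K)) else 0) with hB
      set C : ℝ := μ (h + K - lo) with hC
      have e1 : sHub lo K (γ :: P) h = (1 - γ) * A + γ * B := happ h
      have e2 : sHub lo K (γ :: P) (h + K) = (1 - γ) * C + γ * A := by
        rw [happ (h + K), if_pos (show lo ≤ h + K by omega)]
        congr 2
        by_cases h1 : lo ≤ h
        · rw [hA, if_pos h1, if_pos (show lo + K ≤ h + K by omega), show h + K - (lo + K) = h - lo by omega]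
        · rw [hA, if_neg h1, if_neg (show ¬ (lo + K ≤ h + K) by omega)]
      have hA0 : 0 ≤ A := by rw [hA]; split_ifs; exact a0 _; exact le_rfl
      -- (a) `o((lo+K)j + lo − h)·A ≤ (h + K − lo − lo·j)·C`
      have fa : o * (((lo : ℝ) + K) * j + lo - h) * A ≤ ((h : ℝ) + K - lo - (lo : ℝ) * j) * C := by
        by_cases h1 : lo ≤ h
        · have := hlr (h - lo)
          have ec : ((h - lo : ℕ) : ℝ) = (h : ℝ) - lo := by rw [Nat.cast_sub h1]
          rw [ec, show h - lo + K = h + K - lo by omega] at this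
          rw [hA, if_pos h1, hC]
          have e3 : o * (((lo : ℝ) + K) * j + lo - h) = o * (((lo : ℝ) + K) * j - ((h : ℝ) - lo)) := by ring
          have e4 : ((h : ℝ) + K - lo - (lo : ℝ) * j) = ((h : ℝ) - lo + K - (lo : ℝ) * j) := by ring
          rw [e3, e4]; exact this
        · rw [hA, if_neg h1, mul_zero, hC]
          rcases eq_or_ne (μ (h + K - lo)) 0 with hz | hnz
          · rw [hz, mul_zero]
          · obtain ⟨s, hs, _⟩ := hsupp _ hnz
            have : (lo : ℝ) * j ≤ (h : ℝ) + K - lo := by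
              have hn : lo * j ≤ h + K - lo := by rw [hs]; exact Nat.le_add_right _ _
              have : ((lo * j : ℕ) : ℝ) ≤ ((h + K - lo : ℕ) : ℝ) := by exact_mod_cast hn
              rw [Nat.cast_sub (by omega)] at this
              push_cast at this
              linarith
            exact mul_nonneg (by linarith) (a0 _)
      -- (b) `o((lo+K)j + lo + K − h)·B ≤ (h − lo − lo·j)·A`
      have fb : o * (((lo : ℝ) + K) * j + lo + K - h) * B ≤ ((h : ℝ) - lo - (lo : ℝ) * j) * A := by
        by_cases h3 : lo + K ≤ h
        · have := hlr (h - (lo + K))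
          have ec : ((h - (lo + K) : ℕ) : ℝ) = (h : ℝ) - lo - K := by
            rw [Nat.cast_sub h3]; push_cast; ring
          rw [ec, show h - (lo + K) + K = h - lo by omega] at this
          rw [hB, if_pos h3, hA, if_pos (show lo ≤ h by omega)]
          have e3 : o * (((lo : ℝ) + K) * j + lo + K - h) = o * (((lo : ℝ) + K) * j - ((h : ℝ) - lo - K)) := by ring
          have e4 : ((h : ℝ) - lo - (lo : ℝ) * j) = ((h : ℝ) - lo - K + K - (lo : ℝ) * j) := by ring
          rw [e3, e4]; exact this
        · rw [hB, if_neg h3, mul_zero]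
          rcases eq_or_ne A 0 with hz | hnz
          · rw [hz, mul_zero]
          · have h1 : lo ≤ h := by by_contra hc; exact hnz (by rw [hA, if_neg hc])
            have hA' : μ (h - lo) ≠ 0 := by rw [hA, if_pos h1] at hnz; exact hnz
            obtain ⟨s, hs, _⟩ := hsupp (h - lo) hA'
            have : (lo : ℝ) * j ≤ (h : ℝ) - lo := by
              have hn : lo * j ≤ h - lo := by rw [hs]; exact Nat.le_add_right _ _
              have : ((lo * j : ℕ) : ℝ) ≤ ((h - lo : ℕ) : ℝ) := by exact_mod_cast hn
              rw [Nat.cast_sub h1] at this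
              push_cast at this
              linarith
            exact mul_nonneg (by linarith) hA0
      rw [hlen, e1, e2]
      push_cast
      have hK0 : (0 : ℝ) ≤ K := Nat.cast_nonneg K
      have key : 0 ≤ (K : ℝ) * (A * (γ - o * (1 - γ))) := mul_nonneg hK0 (mul_nonneg hA0 (by linarith [hγ.2.2]))
      have p1 := mul_le_mul_of_nonneg_left fa (show (0 : ℝ) ≤ 1 - γ by linarith [hγ.2.1])
      have p2 := mul_le_mul_of_nonneg_left fb hγ.1
      nlinarith [p1, p2, key]

end LawDec
end Quant
end Summit.CriticalPhenomena.PercolationContinuityZ3.Theorems
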